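import Summits.QuantumFields.YangMills.Theses.LangevinControlUV

/-!
# `FemtoCurvatureTwoPoint` — faithfulness of the representation datum is load-bearing

Negative lemma for crux `Summit.QuantumFields.YangMills.Theses.LangevinControlUV.
FemtoCurvatureTwoPoint` (item stmt-QuantumFields-9363; cdisprove gen 1, importable extract of
`§ LoadBearing` of the crux workfile
`Summits/QuantumFields/YangMills/Cruxes/FemtoCurvatureTwoPoint/Disproof.lean`).

* `lowerBound_trivialRep_false` — for EVERY compact group `G` (any σ-algebra) and data
  `(a, Γ, β₀, ℓ₀, c)` with `ℓ₀, c > 0`, `a > 0`, `a → 0`, `Γ > 0` on `(0, ℓ₀]`, the crux's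
  lower-bound clause FAILS for the trivial `N`-dimensional representation `ρ = 1` (its plaquette
  field `N - Re tr 1 = 0` vanishes identically, so every covariance is `0`, while `c Γ > 0` is
  demanded on the torus `L = 8`, femto at all large `β`);
* `femtoCurvatureTwoPoint_unfaithful_false` — hence the crux with `r : LatticeRep G` weakened to
  a bare continuous unitary representation is false as soon as ONE compact simple Lie group
  exists (`IsCompactSimpleLieGroup H` for some `H`; the tree proves this for no concrete group —
  `isSimpleCompactGroup_specialUnitaryGroup` is a named unproved fact — which is also why no
  unconditional `¬` of any `∀ G`-crux of this sub-problem is landable today).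
-/

noncomputable section

open Filter Topology MeasureTheory
open Literature.MathematicalPhysics.QuantumFieldTheory Literature.MathematicalPhysics.QuantumLattice

namespace Summit.QuantumFields.YangMills.Theorems.FemtoCurvatureTwoPoint.Negative.UnfaithfulFalse

variable {G : Type} [Group G] [TopologicalSpace G] [IsTopologicalGroup G] [CompactSpace G]
  [MeasurableSpace G] [BorelSpace G] {N : ℕ}

/-- **The lower-bound clause fails for the trivial representation**, for every compact `G`. -/
theorem lowerBound_trivialRep_false {a Γ : ℝ → ℝ} {β₀ ℓ₀ c : ℝ} (hℓ : 0 < ℓ₀) (hc : 0 < c)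
    (ha : ∀ β, 0 < a β) (hat : Tendsto a atTop (𝓝 0)) (hΓ : ∀ s : ℝ, 0 < s → s ≤ ℓ₀ → 0 < Γ s)
    (hlow : ∀ (L : ℕ) [NeZero L] (β : ℝ), β₀ ≤ β → (L : ℝ) * a β ≤ ℓ₀ →
      ∀ n : ℕ, 1 ≤ n → 8 * n ≤ L →
        c * Γ ((n : ℝ) * a β) ≤ (n : ℝ) ^ 8 *
          (wilsonExpectation (d := 4) (L := L) (1 : G →* Matrix (Fin N) (Fin N) ℂ) β (fun U =>
              ((N : ℝ) - ((1 : G →* Matrix (Fin N) (Fin N) ℂ)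
                (plaquetteHolonomy U (0 : Site 4 L) 0 1)).trace.re) *
                ((N : ℝ) - ((1 : G →* Matrix (Fin N) (Fin N) ℂ)
                  (plaquetteHolonomy U (Pi.single (2 : Fin 4) ((n : ℕ) : ZMod L)) 0 1)).trace.re)) -
            wilsonExpectation (d := 4) (L := L) (1 : G →* Matrix (Fin N) (Fin N) ℂ) β
                (fun U => (N : ℝ) - ((1 : G →* Matrix (Fin N) (Fin N) ℂ)
                  (plaquetteHolonomy U (0 : Site 4 L) 0 1)).trace.re) *
              wilsonExpectation (d := 4) (L := L) (1 : G →* Matrix (Fin N) (Fin N) ℂ) β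
                (fun U => (N : ℝ) - ((1 : G →* Matrix (Fin N) (Fin N) ℂ)
                  (plaquetteHolonomy U (Pi.single (2 : Fin 4) ((n : ℕ) : ZMod L)) 0 1)).trace.re))) :
    False := by
  haveI : NeZero (8 : ℕ) := ⟨by norm_num⟩
  have h2 : ∀ᶠ β in atTop, a β < ℓ₀ / 8 := hat (Iio_mem_nhds (by positivity))
  obtain ⟨β, hβ, hβ'⟩ := ((eventually_ge_atTop β₀).and h2).exists
  have h8 : ((8 : ℕ) : ℝ) * a β ≤ ℓ₀ := by push_cast; linarith
  have h := hlow 8 β hβ h8 1 le_rfl (by norm_num)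
  simp only [MonoidHom.one_apply, Matrix.trace_one, Fintype.card_fin, Complex.natCast_re, sub_self,
    mul_zero, Nat.cast_one, one_mul, one_pow] at h
  have hE : wilsonExpectation (d := 4) (L := 8) (1 : G →* Matrix (Fin N) (Fin N) ℂ) β
      (fun _ : GaugeConfig 4 8 G => (0 : ℝ)) = 0 := by
    simp [wilsonExpectation]
  rw [hE] at h
  have hs : 0 < a β ∧ a β ≤ ℓ₀ := ⟨ha β, by linarith [ha β]⟩
  have := mul_pos hc (hΓ _ hs.1 hs.2)
  linarith

omit [MeasurableSpace G] [BorelSpace G] in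
/-- **The unfaithful variant of the crux is false** relative to the existence of one compact
simple Lie group: `FemtoCurvatureTwoPoint` with `r : LatticeRep G` replaced by a bare continuous
unitary `ρ : G →* U(N)` (everything else verbatim) fails at `(H, ρ = 1)`. -/
theorem femtoCurvatureTwoPoint_unfaithful_false (hH : IsCompactSimpleLieGroup G) :
    ¬ (∀ (G : Type) [Group G] [TopologicalSpace G] [IsTopologicalGroup G] [CompactSpace G],
        IsCompactSimpleLieGroup G →
          letI : MeasurableSpace G := borel G
          haveI : BorelSpace G := ⟨rfl⟩
          ∀ (N : ℕ) (ρ : G →* Matrix (Fin N) (Fin N) ℂ), Continuous ρ →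
            (∀ g, ρ g ∈ Matrix.unitaryGroup (Fin N) ℂ) →
            ∃ (a : ℝ → ℝ), ∃ (Γ : ℝ → ℝ) (β₀ ℓ₀ c C : ℝ), 0 < ℓ₀ ∧ 0 < c ∧ (∀ β, 0 < a β) ∧
              Filter.Tendsto a Filter.atTop (nhds 0) ∧
              (∀ s : ℝ, 0 < s → s ≤ ℓ₀ → 0 < Γ s ∧ Γ s ≤ 1) ∧
              ∀ (L : ℕ) [NeZero L] (β : ℝ), β₀ ≤ β → (L : ℝ) * a β ≤ ℓ₀ →
                let P : (Fin 4 → ZMod L) → Fin 4 → Fin 4 → GaugeConfig 4 L G → ℝ :=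
                  fun x i j U => (N : ℝ) - (ρ (plaquetteHolonomy U x i j)).trace.re
                let E : (GaugeConfig 4 L G → ℝ) → ℝ := fun F =>
                  wilsonExpectation (d := 4) (L := L) ρ β F
                let cov : (GaugeConfig 4 L G → ℝ) → (GaugeConfig 4 L G → ℝ) → ℝ := fun F F' =>
                  E (fun U => F U * F' U) - E F * E F'
                let dist : (Fin 4 → ZMod L) → (Fin 4 → ZMod L) → ℝ := fun x y =>
                  Real.sqrt (∑ k : Fin 4, (((x k - y k).valMinAbs : ℤ) : ℝ) ^ 2)
                (∀ n : ℕ, 1 ≤ n → 8 * n ≤ L →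
                    c * Γ ((n : ℝ) * a β) ≤
                        (n : ℝ) ^ 8 * cov (P 0 0 1) (P (Pi.single (2 : Fin 4) ((n : ℕ) : ZMod L)) 0 1) ∧
                      (n : ℝ) ^ 8 * cov (P 0 0 1) (P (Pi.single (2 : Fin 4) ((n : ℕ) : ZMod L)) 0 1) ≤
                        C * Γ ((n : ℝ) * a β)) ∧
                  (∀ (x y : Fin 4 → ZMod L) (i j i' j' : Fin 4), x ≠ y → i ≠ j → i' ≠ j' →
                    |cov (P x i j) (P y i' j')| * dist x y ^ 8 ≤ C * Γ (dist x y * a β))) := by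
  intro h
  letI : MeasurableSpace G := borel G
  haveI : BorelSpace G := ⟨rfl⟩
  obtain ⟨a, Γ, β₀, ℓ₀, c, C, hℓ, hc, ha, hat, hΓ, hcl⟩ :=
    h G hH 1 1 continuous_const (fun g => by simp)
  exact lowerBound_trivialRep_false (G := G) (N := 1) hℓ hc ha hat (fun s hs hs' => (hΓ s hs hs').1)
    fun L _ β hβ hL n hn hnL => ((hcl L β hβ hL).1 n hn hnL).1

/-- … in particular relative to the tree's named fact that `SU(n)`, `n ≥ 2`, is compact simple. -/
theorem femtoCurvatureTwoPoint_unfaithful_false_of_su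
    (hSU : isSimpleCompactGroup_specialUnitaryGroup.{0}) :
    ¬ (∀ (G : Type) [Group G] [TopologicalSpace G] [IsTopologicalGroup G] [CompactSpace G],
        IsCompactSimpleLieGroup G →
          letI : MeasurableSpace G := borel G
          haveI : BorelSpace G := ⟨rfl⟩
          ∀ (N : ℕ) (ρ : G →* Matrix (Fin N) (Fin N) ℂ), Continuous ρ →
            (∀ g, ρ g ∈ Matrix.unitaryGroup (Fin N) ℂ) →
            ∃ (a : ℝ → ℝ), ∃ (Γ : ℝ → ℝ) (β₀ ℓ₀ c C : ℝ), 0 < ℓ₀ ∧ 0 < c ∧ (∀ β, 0 < a β) ∧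
              Filter.Tendsto a Filter.atTop (nhds 0) ∧
              (∀ s : ℝ, 0 < s → s ≤ ℓ₀ → 0 < Γ s ∧ Γ s ≤ 1) ∧
              ∀ (L : ℕ) [NeZero L] (β : ℝ), β₀ ≤ β → (L : ℝ) * a β ≤ ℓ₀ →
                let P : (Fin 4 → ZMod L) → Fin 4 → Fin 4 → GaugeConfig 4 L G → ℝ :=
                  fun x i j U => (N : ℝ) - (ρ (plaquetteHolonomy U x i j)).trace.re
                let E : (GaugeConfig 4 L G → ℝ) → ℝ := fun F =>
                  wilsonExpectation (d := 4) (L := L) ρ β F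
                let cov : (GaugeConfig 4 L G → ℝ) → (GaugeConfig 4 L G → ℝ) → ℝ := fun F F' =>
                  E (fun U => F U * F' U) - E F * E F'
                let dist : (Fin 4 → ZMod L) → (Fin 4 → ZMod L) → ℝ := fun x y =>
                  Real.sqrt (∑ k : Fin 4, (((x k - y k).valMinAbs : ℤ) : ℝ) ^ 2)
                (∀ n : ℕ, 1 ≤ n → 8 * n ≤ L →
                    c * Γ ((n : ℝ) * a β) ≤
                        (n : ℝ) ^ 8 * cov (P 0 0 1) (P (Pi.single (2 : Fin 4) ((n : ℕ) : ZMod L)) 0 1) ∧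
                      (n : ℝ) ^ 8 * cov (P 0 0 1) (P (Pi.single (2 : Fin 4) ((n : ℕ) : ZMod L)) 0 1) ≤
                        C * Γ ((n : ℝ) * a β)) ∧
                  (∀ (x y : Fin 4 → ZMod L) (i j i' j' : Fin 4), x ≠ y → i ≠ j → i' ≠ j' →
                    |cov (P x i j) (P y i' j')| * dist x y ^ 8 ≤ C * Γ (dist x y * a β))) :=
  femtoCurvatureTwoPoint_unfaithful_false
    (isCompactSimpleLieGroup_specialUnitaryGroup hSU (n := 2) le_rfl)

end Summit.QuantumFields.YangMills.Theorems.FemtoCurvatureTwoPoint.Negative.UnfaithfulFalse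

end
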